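import Summits.HodgeConjecture.HodgeConjecture.Theorems.PadicSemiregularLiftHodgeLocusPropagationGenericPoints
import Summits.HodgeConjecture.HodgeConjecture.Theorems.PadicSemiregularLiftHodgeLocusPropagationCurves

/-!
# Route PadicSemiregularLift — support item `HodgeLocusPropagation` (stmt-HodgeConjecture-14977) PROVED AS TYPED

HONEST FRAMING: research route conditional on HC_CM; not a corollary; Q11.4-sentence-2 already refuted in dim ≥ 3.
Cell `pub-hodge-ring2`, binder seat `ring2-b03` (gen 42). No definition, no named fact, no `sorry`;
`HC_CM` does not occur.

The route decl `Theses.PadicSemiregularLift.HodgeLocusPropagation` (P2c-GLUE G): for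
`σ : ℚ̄ →+* ℂ`, `f₀ : 𝒳₀ ⟶ S₀` over `ℚ̄` with `S₀` quasi-projective (inlined) and irreducible, whose
complexification is a smooth projective family of relative dimension `n`, a global class
`A ∈ H²ᵖ(𝒳(ℂ); ℂ)` algebraic on the fibre over a `ℚ̄`-GENERIC `s ∈ S(ℂ)` is algebraic on every
fibre. The earlier file `PadicSemiregularLiftHodgeLocusPropagation.lean` proved it WITH the extra
binder "`𝒳₀` quasi-projective" and CONDITIONALLY on the vendored named fact
`voisin2007_algebraicityLocus_iUnion_qbarClosed` (relative Hilbert schemes). This file proves it AS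
TYPED — no hypothesis on the total space beyond the route's, no named fact — by the spreading
argument of Voisin II §3.3.1 / Charles–Schnell Prop. 11.3.11 run on supports and curves (the
binder seat's gens 31–34 machinery for stub G of line `padic-disc-transport`, there for curve
bases), extended to bases of any dimension:

* `exists_isIntegral_isAffine_isDominant` — reduction of the base: through any point of an
  irreducible `k`-scheme passes a dominant, locally-of-finite-type morphism from an INTEGRAL AFFINE
  `k`-scheme (an affine open `Spec R ∋ x` and its reduction `Spec (R/𝔑) → Spec R`, a surjective
  closed immersion; `𝔑` is prime because `Spec R` is irreducible).
* `hodgeLocusPropagation_proof` — **the route decl.** `s` is over the generic point of `S₀`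
  (`qbarGeneric_iff_base_pt_eq_genericPoint`); pull the family back to an integral affine
  `S₁ → S₀` through the point under `t` (fibres do not change, `exists_fiberOver_iso_of_isPullback`);
  lift `s` and `t` to complex points of `S₁ ⊗ ℂ` (`exists_map_eq_of_base_pt_eq`), `s` to one over
  the generic point of `S₁`; then
  `mem_algebraicClasses_of_base_pt_eq_genericPoint_of_base_pt_eq_genericPoint` (algebraic at every
  complex point over the generic point: spread, death constancy, conjugation of the dimension
  bound) and `mem_algebraicClasses_of_forall_base_pt_eq_genericPoint` (Mumford curve through `t`,
  countable-subfield descent, `everywherePropagation`).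

References: [Voisin2007HodgeLoci] §0, §3; [VoisinHodgeII2003] §3.3.1; [CharlesSchnell2014Notes]
Prop. 11.3.11 (proof), Lemma 11.3.14; [MumfordAV1970] §6 Lemma; [Lang1958IAG] II §3, III §4.
-/

noncomputable section

-- every declaration of this problem lives in `Summit.HodgeConjecture.HodgeConjecture.…` (summit = sub-problem)
set_option linter.dupNamespace false

open CategoryTheory CategoryTheory.Limits AlgebraicGeometry TopologicalSpace Order Cardinal
open Literature.AlgebraicGeometry.Motives Literature.AlgebraicGeometry.HodgeTheory

namespace Summit.HodgeConjecture.HodgeConjecture.Theorems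

/-- **Through any point of an irreducible `k`-scheme passes a dominant morphism, locally of finite
type, from an integral affine `k`-scheme**: an affine open `j : Spec R ↪ S₀` through `x` is
irreducible (it contains the generic point), so the nilradical `𝔑` of `R` is prime and
`Spec (R/𝔑) → Spec R → S₀` is a surjective closed immersion onto the dense open `Spec R`
(the reduced structure on an affine open; Hartshorne II Ex. 2.3, Ex. 3.11). [cite: Hartshorne1977, II Ex. 2.3 and Prop. 3.1] -/
theorem exists_isIntegral_isAffine_isDominant {k : Type} [Field k] (S₀ : SchemeOver k)
    [IrreducibleSpace S₀.left] (x : S₀.left) :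
    ∃ (S₁ : SchemeOver k) (ι : S₁ ⟶ S₀), IsIntegral S₁.left ∧ IsAffine S₁.left ∧
      LocallyOfFiniteType ι.left ∧ IsDominant ι.left ∧ x ∈ Set.range ι.left.base := by
  classical
  obtain ⟨R, j, hj, y, hy⟩ := Scheme.exists_Spec_apply_eq x
  -- the generic point of `S₀` lies in the (open, non-empty) image of `j`
  obtain ⟨y₀, hy₀⟩ : genericPoint S₀.left ∈ Set.range j.base :=
    ((genericPoint_spec S₀.left).mem_open_set_iff j.isOpenEmbedding.isOpen_range).mpr
      ⟨x, trivial, y, hy⟩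
  -- `Spec R` is irreducible: `y₀` is a generic point
  have hcl : closure ({y₀} : Set ↥(Spec R)) = Set.univ := by
    have h1 : j.base ⁻¹' closure ({genericPoint S₀.left} : Set S₀.left) =
        closure (j.base ⁻¹' {genericPoint S₀.left}) :=
      j.isOpenEmbedding.isOpenMap.preimage_closure_eq_closure_preimage j.base.hom.continuous _
    have h2 : j.base ⁻¹' ({genericPoint S₀.left} : Set S₀.left) = {y₀} := by
      ext z
      simp only [Set.mem_preimage, Set.mem_singleton_iff]
      exact ⟨fun hz => j.isOpenEmbedding.injective (hz.trans hy₀.symm), fun hz => hz ▸ hy₀⟩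
    rw [← h2, ← h1, genericPoint_closure, Set.preimage_univ]
  haveI : IrreducibleSpace ↥(Spec R) :=
    (irreducibleSpace_def _).2 (IsGenericPoint.isIrreducible (S := Set.univ) hcl)
  -- hence the nilradical of `R` is prime
  haveI hN : (nilradical R).IsPrime := by
    have huniv : IsIrreducible (Set.univ : Set (PrimeSpectrum R)) :=
      IrreducibleSpace.isIrreducible_univ ↥(Spec R)
    have h := PrimeSpectrum.isIrreducible_iff_vanishingIdeal_isPrime.mp huniv
    rwa [PrimeSpectrum.vanishingIdeal_univ] at h
  haveI : IsDomain (R ⧸ nilradical R) := Ideal.Quotient.isDomain (nilradical (R : Type))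
  -- the reduction `Spec (R/𝔑) → Spec R`: a surjective closed immersion
  let π : (R : Type) →+* R ⧸ nilradical R := Ideal.Quotient.mk (nilradical (R : Type))
  let ι₁ : Spec (CommRingCat.of (R ⧸ nilradical R)) ⟶ Spec R := Spec.map (CommRingCat.ofHom π)
  haveI : IsClosedImmersion ι₁ :=
    IsClosedImmersion.spec_of_surjective _ Ideal.Quotient.mk_surjective
  have hsurj : Function.Surjective ι₁.base := fun z =>
    (PrimeSpectrum.comap_quotientMk_bijective_of_le_nilradical
      (I := nilradical (R : Type)) le_rfl).2 z
  let S₁ : SchemeOver k := Over.mk ((ι₁ ≫ j) ≫ S₀.hom)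
  let ι : S₁ ⟶ S₀ := Over.homMk (ι₁ ≫ j) rfl
  refine ⟨S₁, ι, ?_, ?_, ?_, ?_, ?_⟩
  · change IsIntegral (Spec (CommRingCat.of (R ⧸ nilradical R)))
    infer_instance
  · change IsAffine (Spec (CommRingCat.of (R ⧸ nilradical R)))
    infer_instance
  · change LocallyOfFiniteType (ι₁ ≫ j)
    infer_instance
  · change IsDominant (ι₁ ≫ j)
    obtain ⟨w₀, hw₀⟩ := hsurj y₀
    have hmem : genericPoint S₀.left ∈ Set.range (ι₁ ≫ j).base :=
      ⟨w₀, by simp only [Scheme.Hom.comp_base, TopCat.coe_comp, Function.comp_apply, hw₀, hy₀]⟩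
    exact ⟨(dense_iff_closure_eq.2 (genericPoint_closure _)).mono (Set.singleton_subset_iff.2 hmem)⟩
  · obtain ⟨w, hw⟩ := hsurj y
    refine ⟨w, ?_⟩
    change (ι₁ ≫ j).base w = x
    simp only [Scheme.Hom.comp_base, TopCat.coe_comp, Function.comp_apply, hw, hy]

/-- **`HodgeLocusPropagation` (route `HodgeConjecture/PadicSemiregularLift`, support item
stmt-HodgeConjecture-14977), proved as typed.** For `σ : ℚ̄ →+* ℂ`, `f₀ : 𝒳₀ ⟶ S₀` over `ℚ̄` with
`S₀` quasi-projective and irreducible whose complexification is a smooth projective family of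
relative dimension `n`, `A ∈ H²ᵖ(𝒳(ℂ); ℂ)` and a `ℚ̄`-generic `s ∈ S(ℂ)` with `A|_{𝒳_s}`
algebraic, `A|_{𝒳_t}` is algebraic for every `t ∈ S(ℂ)` (module docstring; Voisin 2007 §0 "the
algebraicity of the class at a point generic over `ℚ̄` spreads"; Charles–Schnell Prop. 11.3.11).
[cite: Voisin2007HodgeLoci, §0 (Introduction), first paragraph]
[cite: CharlesSchnell2014Notes, Prop. 11.3.11 (proof) and Lemma 11.3.14]
[cite: VoisinHodgeII2003, §3.3.1] [cite: MumfordAV1970, §6, Lemma] -/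
theorem hodgeLocusPropagation_proof : Theses.PadicSemiregularLift.HodgeLocusPropagation := by
  intro σ 𝒳₀ S₀ f₀ n p hS₀ hirr hf A s hs hA t
  classical
  letI := σ.toAlgebra
  haveI := hirr
  haveI : Countable (AlgebraicClosure ℚ) :=
    Cardinal.mk_le_aleph0_iff.mp cardinalMk_algebraicClosure_rat_le_aleph0
  have hK : #(AlgebraicClosure ℚ) ≤ ℵ₀ := cardinalMk_algebraicClosure_rat_le_aleph0
  have hS₀' : IsQuasiProjectiveOver S₀ := hS₀
  haveI : LocallyOfFiniteType S₀.hom := locallyOfFiniteType_of_isQuasiProjectiveOver hS₀'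
  -- `s` lies over the generic point of `S₀`
  have hsη : (baseChangeHomFst σ S₀).base s.pt = genericPoint S₀.left :=
    (qbarGeneric_iff_base_pt_eq_genericPoint σ hS₀' s).mp hs
  -- ### notation
  let 𝒳 : SchemeOver ℂ := (baseChangeHom σ).obj 𝒳₀
  let S : SchemeOver ℂ := (baseChangeHom σ).obj S₀
  let f : 𝒳 ⟶ S := (baseChangeHom σ).map f₀
  let prS : S.left ⟶ S₀.left := baseChangeHomFst σ S₀
  -- ### an integral affine `S₁ → S₀`, dominant, through the point under `t`
  obtain ⟨S₁, ι, hS₁int, hS₁aff, hιlft, hιdom, y, hy⟩ :=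
    exists_isIntegral_isAffine_isDominant S₀ (prS.base t.pt)
  haveI := hS₁int
  haveI := hS₁aff
  haveI := hιlft
  haveI := hιdom
  haveI : LocallyOfFiniteType S₁.hom := by rw [← Over.w ι]; infer_instance
  haveI : IsAffineHom S₁.hom := isAffineHom_of_isAffine S₁.hom
  haveI : CompactSpace S₁.left := QuasiCompact.compactSpace_of_compactSpace S₁.hom
  -- ### the family pulled back to `S₁`, and its complexification
  let f₀' : familyPullback f₀ ι ⟶ S₁ := familyPullback.snd f₀ ι
  let q₀' : familyPullback f₀ ι ⟶ 𝒳₀ := familyPullback.fst f₀ ι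
  have Hsq : IsPullback q₀'.left f₀'.left f₀.left ι.left := IsPullback.of_hasPullback f₀.left ι.left
  let S' : SchemeOver ℂ := (baseChangeHom σ).obj S₁
  let f' : (baseChangeHom σ).obj (familyPullback f₀ ι) ⟶ S' := (baseChangeHom σ).map f₀'
  let q' : (baseChangeHom σ).obj (familyPullback f₀ ι) ⟶ 𝒳 := (baseChangeHom σ).map q₀'
  let h' : S' ⟶ S := (baseChangeHom σ).map ι
  have HsqC : IsPullback q' f' f h' := isPullback_baseChangeHom_map_of_isPullback' σ Hsq
  have Hl : IsPullback q'.left f'.left f.left h'.left := isPullback_baseChangeHom_map_of_isPullback σ Hsq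
  have hf' : IsSmoothProjectiveFamily f' n := by
    refine ⟨?_, ?_, fun w => ?_⟩
    · haveI := smoothOfRelativeDimension_isStableUnderBaseChange (n := n)
      exact MorphismProperty.of_isPullback (P := @SmoothOfRelativeDimension n) Hl
        hf.smoothOfRelativeDimension
    · exact MorphismProperty.of_isPullback (P := @IsProper) Hl hf.isProper
    · obtain ⟨φ, -⟩ := exists_fiberOver_iso_of_isPullback HsqC w
      exact (hf.isSmoothProjective _).of_iso φ.symm
  let A' : complexBetti ((baseChangeHom σ).obj (familyPullback f₀ ι)) (2 * p) :=
    complexBetti.map q' (2 * p) A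
  -- algebraicity on the fibres of `f'` is algebraicity on the fibres of `f` at the image points
  have hfib : ∀ w : ComplexPoints S',
      complexBetti.map (fiberι f' w) (2 * p) A' ∈ algebraicClasses (fiberOver f' w) p ↔
        complexBetti.map (fiberι f (AlgPoints.map h' w)) (2 * p) A ∈
          algebraicClasses (fiberOver f (AlgPoints.map h' w)) p := by
    intro w
    obtain ⟨φ, hφ⟩ := exists_fiberOver_iso_of_isPullback HsqC w
    rw [show complexBetti.map (fiberι f' w) (2 * p) A' =
        complexBetti.map φ.hom (2 * p) (complexBetti.map (fiberι f (AlgPoints.map h' w)) (2 * p) A)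
      from map_fiberι_map_eq_map_of_fiberIso f q' f' φ hφ (2 * p) A]
    exact mem_algebraicClasses_map_iff_of_iso φ
  -- ### lift `s` to a complex point of `S₁ ⊗ ℂ` over the generic point of `S₁`, and lift `t`
  have hη : ι.left.base (genericPoint S₁.left) = prS.base s.pt := by
    rw [hsη]; exact genericPoint_eq_of_isDominant' ι.left
  obtain ⟨s', hs'η, hs's⟩ := exists_map_eq_of_base_pt_eq (σ := σ) ι hK hη
  obtain ⟨t', -, ht't⟩ := exists_map_eq_of_base_pt_eq (σ := σ) ι hK (y := y) (t := t) hy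
  -- ### the argument over the integral base `S₁`
  have hA' : complexBetti.map (fiberι f' s') (2 * p) A' ∈ algebraicClasses (fiberOver f' s') p := by
    refine (hfib s').mpr ?_
    rw [hs's]
    exact hA
  have hgen : ∀ v : ComplexPoints S', (baseChangeHomFst σ S₁).base v.pt = genericPoint S₁.left →
      complexBetti.map (fiberι f' v) (2 * p) A' ∈ algebraicClasses (fiberOver f' v) p :=
    fun v hv => mem_algebraicClasses_of_base_pt_eq_genericPoint_of_base_pt_eq_genericPoint
      (AlgebraicClosure ℚ) σ f₀' hf' p A' s' hs'η hA' v hv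
  have ht' := mem_algebraicClasses_of_forall_base_pt_eq_genericPoint (AlgebraicClosure ℚ) σ f₀'
    hf' p A' hgen t'
  have ht := (hfib t').mp ht'
  rwa [ht't] at ht

end Summit.HodgeConjecture.HodgeConjecture.Theorems

end
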